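import Literature.Analysis.FluidPDE.PassiveScalarDiagGalerkin
import HarnessLib

/-!
# The Fourier–Galerkin energy argument for weak passive scalars with constant diagonal
# diffusion, II: the truncated energy identity

Analysis/FluidPDE proof-support file (everything proved). For a weak solution
`Torus.IsWeakScalarTransportDiagForcedOn T a κ u s θ₀ θ` of `∂ₜθ + u·∇θ = κ ∑ᵢ aᵢ ∂ᵢ∂ᵢθ + s` on
`T^d × [0,T)` with integrable datum, the Galerkin truncations `P_N θ = Torus.scalarTruncate N θ`
satisfy, for every `N` and a.e. `t ∈ (0,T)`, the **truncated energy identity**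

  `‖P_N θ(t)‖² = ‖P_N θ₀‖² + 2∫_{(0,t]} ( ∫ θ ⟪u, ∇P_N θ⟫ - κ‖∇P_N θ‖²_a + ∫ s P_N θ ) dτ`

(`IsWeakScalarTransportDiagForcedOn.ae_galerkin_energy_eq`, with `‖P_N θ‖² = ∑_{|k|≤N}|θ̂(k)|²` and
`‖∇P_N θ‖²_a = 4π² ∑_{|k|≤N} Q_a(k)|θ̂(k)|²`), obtained by summing the mode-by-mode identities of
`PassiveScalarDiagGalerkin`; the three time-integrands are integrable on `(0,T)`
(`integrableOn_galerkin_transport/diss/source`), and for an `L^∞` drift the transport pairing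
only sees the truncation remainder, `∫ θ ⟪u, ∇P_N θ⟫ = ∫ (θ - P_N θ) ⟪u, ∇P_N θ⟫`
(`ae_galerkin_transport_eq_remainder`: weak incompressibility gives `∫ P_N θ ⟪u, ∇P_N θ⟫ = 0`,
Robinson–Rodrigo–Sadowski 2016, (4.20)). The limit `N → ∞` is taken in `PassiveScalarDiagGalerkinBounds`,
`PassiveScalarDiagEnergy`, `PassiveScalarDiagEnergyEquality`.

## References

* J. C. Robinson, J. L. Rodrigo, W. Sadowski, *The three-dimensional Navier–Stokes equations*
  (CUP 2016), §4.1–4.2, (4.20). [`RobinsonRodrigoSadowski2016`]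
* P. Bonicatto, G. Ciampa, G. Crippa, J. Evol. Equ. 24 (2024), Paper No. 1, proof of Thm. 3.3,
  (3.1). [`BonicattoCiampaCrippa2023`]
-/

noncomputable section

open _root_.MeasureTheory _root_.Set _root_.Filter _root_.Function _root_.TopologicalSpace
open scoped ENNReal NNReal InnerProductSpace ContDiff Topology
open Literature.Analysis.FunctionSpaces.Torus Literature.Analysis.FunctionSpaces UnitAddTorus

namespace Literature.Analysis.FluidPDE

variable {d : Type*} [Fintype d] [DecidableEq d]

namespace Torus

namespace IsWeakScalarTransportDiagForcedOn

variable {T κ : ℝ} {a : d → ℝ} {u : ℝ → UnitAddTorus d → EuclideanSpace ℝ d} {s : ℝ → UnitAddTorus d → ℝ}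
  {θ₀ : UnitAddTorus d → ℝ} {θ : ℝ → UnitAddTorus d → ℝ}

/-! ## The Galerkin energy identity -/

/-- Good times: for a.e. `τ ∈ (0,T)` the slices `θ τ`, `s τ` are integrable, `u τ` is
a.e.-strongly measurable and `‖u τ‖ θ τ ∈ L¹`, so that the summed right-hand side is identified
(`galerkin_sum_rhs_eq`). [folklore] -/
private theorem ae_sum_rhs_eq (h : IsWeakScalarTransportDiagForcedOn T a κ u s θ₀ θ) (N : ℕ) :
    ∀ᵐ τ ∂(volume.restrict (Ioo 0 T)),
      ∑ k ∈ freqBall N,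
        (((∫ x, θ τ x * (⟪u τ x, gradient (reTrigPoly {-k} (fun _ => (1 : ℂ))) x⟫_ℝ +
            κ * ∑ i, a i * partialDeriv i (partialDeriv i (reTrigPoly {-k} (fun _ => (1 : ℂ)))) x)) +
            ∫ x, s τ x * reTrigPoly {-k} (fun _ => (1 : ℂ)) x) * (∫ x, θ τ x * reTrigPoly {-k} (fun _ => (1 : ℂ)) x) +
          ((∫ x, θ τ x * (⟪u τ x, gradient (reTrigPoly {-k} (fun _ => -Complex.I)) x⟫_ℝ +
            κ * ∑ i, a i * partialDeriv i (partialDeriv i (reTrigPoly {-k} (fun _ => -Complex.I))) x)) +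
            ∫ x, s τ x * reTrigPoly {-k} (fun _ => -Complex.I) x) *
            (∫ x, θ τ x * reTrigPoly {-k} (fun _ => -Complex.I) x)) =
      (∫ x, θ τ x * ⟪u τ x, gradient (scalarTruncate N (θ τ)) x⟫_ℝ) -
        κ * (4 * Real.pi ^ 2 * ∑ k ∈ freqBall N,
          Torus.diagSymbol a k * ‖mFourierCoeff (fun x => (θ τ x : ℂ)) k‖ ^ 2) +
        ∫ x, s τ x * scalarTruncate N (θ τ) x := by
  filter_upwards [h.ae_slice_integrable] with τ hτ
  exact galerkin_sum_rhs_eq hτ.1 hτ.2.1 hτ.2.2.1 hτ.2.2.2 a κ N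

/-- **The Fourier–Galerkin energy identity** for a weak solution of
`∂ₜθ + u·∇θ = κ ∑ᵢ aᵢ ∂ᵢ∂ᵢθ + s` with integrable datum: for every `N` and a.e. `t ∈ (0,T)`,
`∑_{|k|≤N} |θ̂(t)(k)|² = ∑_{|k|≤N} |θ̂₀(k)|²
   + 2 ∫_{(0,t]} ( ∫ θ ⟪u, ∇P_N θ⟫ - 4π²κ ∑_{|k|≤N} Q_a(k) |θ̂(k)|² + ∫ s P_N θ ) dτ`,
i.e. `‖P_N θ(t)‖² + 2κ ∫₀ᵗ ‖∇P_N θ‖²_a = ‖P_N θ₀‖² + 2∫₀ᵗ (∫ θ u·∇P_N θ + ∫ s P_N θ)` — the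
energy balance of the Galerkin truncation `P_N θ = Torus.scalarTruncate N θ`, obtained WITHOUT an
approximation scheme: each Fourier coefficient of a weak solution is absolutely continuous with
the derivative the equation predicts (`PassiveScalarDiagForcedSteadyTest`), and the finite sum of
the mode-by-mode product rules is identified through `∇P_N θ = ∑ (Re θ̂ₖ ∇Cₖ + Im θ̂ₖ ∇Sₖ)` and the
eigenfunction property of single modes (Robinson–Rodrigo–Sadowski 2016, §4.1–4.2, the Galerkin
energy estimate; Bonicatto–Ciampa–Crippa 2024, proof of Thm. 3.3, (3.1) with `P_N` in place of
the mollifier). [cite: RobinsonRodrigoSadowski2016, §4.2 (Galerkin energy estimate)] -/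
theorem ae_galerkin_energy_eq (h : IsWeakScalarTransportDiagForcedOn T a κ u s θ₀ θ)
    (hθ₀ : Integrable θ₀ volume) (N : ℕ) :
    ∀ᵐ t ∂(volume.restrict (Ioo 0 T)),
      ∑ k ∈ freqBall N, ‖mFourierCoeff (fun x => (θ t x : ℂ)) k‖ ^ 2 =
        ∑ k ∈ freqBall N, ‖mFourierCoeff (fun x => (θ₀ x : ℂ)) k‖ ^ 2 +
        2 * ∫ τ in Ioc 0 t,
          ((∫ x, θ τ x * ⟪u τ x, gradient (scalarTruncate N (θ τ)) x⟫_ℝ) -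
            κ * (4 * Real.pi ^ 2 * ∑ k ∈ freqBall N,
              Torus.diagSymbol a k * ‖mFourierCoeff (fun x => (θ τ x : ℂ)) k‖ ^ 2) +
            ∫ x, s τ x * scalarTruncate N (θ τ) x) := by
  -- the per-mode identities, simultaneously for all modes
  have hmodes : ∀ᵐ t ∂(volume.restrict (Ioo 0 T)), ∀ k : d → ℤ,
      (∫ x, θ t x * reTrigPoly {-k} (fun _ => (1 : ℂ)) x) ^ 2 +
        (∫ x, θ t x * reTrigPoly {-k} (fun _ => -Complex.I) x) ^ 2 =
      (∫ x, θ₀ x * reTrigPoly {-k} (fun _ => (1 : ℂ)) x) ^ 2 +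
        (∫ x, θ₀ x * reTrigPoly {-k} (fun _ => -Complex.I) x) ^ 2 +
      2 * ∫ τ in Ioc 0 t,
        (((∫ x, θ τ x * (⟪u τ x, gradient (reTrigPoly {-k} (fun _ => (1 : ℂ))) x⟫_ℝ +
            κ * ∑ i, a i * partialDeriv i (partialDeriv i (reTrigPoly {-k} (fun _ => (1 : ℂ)))) x)) +
            ∫ x, s τ x * reTrigPoly {-k} (fun _ => (1 : ℂ)) x) * (∫ x, θ τ x * reTrigPoly {-k} (fun _ => (1 : ℂ)) x) +
          ((∫ x, θ τ x * (⟪u τ x, gradient (reTrigPoly {-k} (fun _ => -Complex.I)) x⟫_ℝ +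
            κ * ∑ i, a i * partialDeriv i (partialDeriv i (reTrigPoly {-k} (fun _ => -Complex.I))) x)) +
            ∫ x, s τ x * reTrigPoly {-k} (fun _ => -Complex.I) x) *
            (∫ x, θ τ x * reTrigPoly {-k} (fun _ => -Complex.I) x)) :=
    ae_all_iff.2 fun k => h.ae_mode_energy_eq (isSmooth_reTrigPoly _ _) (isSmooth_reTrigPoly _ _)
  -- integrability of the per-mode integrands on `(0,T)`
  have hint : ∀ k : d → ℤ, IntegrableOn (fun τ =>
      (((∫ x, θ τ x * (⟪u τ x, gradient (reTrigPoly {-k} (fun _ => (1 : ℂ))) x⟫_ℝ +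
          κ * ∑ i, a i * partialDeriv i (partialDeriv i (reTrigPoly {-k} (fun _ => (1 : ℂ)))) x)) +
          ∫ x, s τ x * reTrigPoly {-k} (fun _ => (1 : ℂ)) x) * (∫ x, θ τ x * reTrigPoly {-k} (fun _ => (1 : ℂ)) x) +
        ((∫ x, θ τ x * (⟪u τ x, gradient (reTrigPoly {-k} (fun _ => -Complex.I)) x⟫_ℝ +
          κ * ∑ i, a i * partialDeriv i (partialDeriv i (reTrigPoly {-k} (fun _ => -Complex.I))) x)) +
          ∫ x, s τ x * reTrigPoly {-k} (fun _ => -Complex.I) x) *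
          (∫ x, θ τ x * reTrigPoly {-k} (fun _ => -Complex.I) x))) (Ioo 0 T) volume := by
    intro k
    have hC := isSmooth_reTrigPoly ({-k} : Finset (d → ℤ)) (fun _ => (1 : ℂ))
    have hS := isSmooth_reTrigPoly ({-k} : Finset (d → ℤ)) (fun _ => -Complex.I)
    refine (h.integrableOn_mul_pairing ?_ hC.continuous).add (h.integrableOn_mul_pairing ?_ hS.continuous)
    · exact (h.integrable_mul_steadyFlux hC).integral_prod_left.add
        (h.integrable_source_mul_continuous hC.continuous).integral_prod_left
    · exact (h.integrable_mul_steadyFlux hS).integral_prod_left.add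
        (h.integrable_source_mul_continuous hS.continuous).integral_prod_left
  have hrhs' : ∀ᵐ τ ∂(volume : Measure ℝ), τ ∈ Ioo 0 T → _ :=
    (ae_restrict_iff' measurableSet_Ioo).1 (h.ae_sum_rhs_eq N)
  filter_upwards [hmodes, h.ae_slice_integrable, ae_restrict_mem measurableSet_Ioo] with t ht hslice htT
  have hsub : Ioc 0 t ⊆ Ioo 0 T := Ioc_subset_Ioo_right htT.2
  -- left-hand side and datum: `|θ̂(k)|² = Aₖ² + Bₖ²`
  simp_rw [sq_norm_mFourierCoeff_ofReal hslice.1, sq_norm_mFourierCoeff_ofReal hθ₀]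
  rw [Finset.sum_congr rfl fun k _ => ht k, Finset.sum_add_distrib, ← Finset.mul_sum,
    ← integral_finsetSum _ fun k _ => (hint k).mono_set hsub]
  congr 2
  refine setIntegral_congr_ae measurableSet_Ioc ?_
  filter_upwards [hrhs'] with τ hτ hτI
  exact hτ (hsub hτI)



/-! ## Integrability in time of the Galerkin quantities -/

/-- The squared mode pairings `Aₖ(τ)² + Bₖ(τ)²` are integrable on `(0,T)` (each pairing is
integrable and essentially bounded). [cite: RobinsonRodrigoSadowski2016, §4.2 (Galerkin energy estimate)] -/
theorem integrableOn_pairing_sq (h : IsWeakScalarTransportDiagForcedOn T a κ u s θ₀ θ) (k : d → ℤ) :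
    IntegrableOn (fun τ =>
      (∫ x, θ τ x * reTrigPoly {-k} (fun _ => (1 : ℂ)) x) * (∫ x, θ τ x * reTrigPoly {-k} (fun _ => (1 : ℂ)) x) +
      (∫ x, θ τ x * reTrigPoly {-k} (fun _ => -Complex.I) x) * (∫ x, θ τ x * reTrigPoly {-k} (fun _ => -Complex.I) x))
      (Ioo 0 T) volume := by
  have hC := continuous_reTrigPoly ({-k} : Finset (d → ℤ)) (fun _ => (1 : ℂ))
  have hS := continuous_reTrigPoly ({-k} : Finset (d → ℤ)) (fun _ => -Complex.I)
  exact (h.integrableOn_mul_pairing ((h.integrable_mul_continuous hC).integral_prod_left) hC).add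
    (h.integrableOn_mul_pairing ((h.integrable_mul_continuous hS).integral_prod_left) hS)

/-- **The truncated `A`-dissipation is integrable in time**:
`τ ↦ 4π² ∑_{|k|≤N} Q_a(k) |θ̂(τ)(k)|² ∈ L¹(0,T)` (each `|θ̂(τ)(k)|² = Aₖ² + Bₖ²` with `Aₖ, Bₖ`
essentially bounded pairings). [cite: RobinsonRodrigoSadowski2016, §4.2 (Galerkin energy estimate)] -/
theorem integrableOn_galerkin_diss (h : IsWeakScalarTransportDiagForcedOn T a κ u s θ₀ θ) (N : ℕ) :
    IntegrableOn (fun τ => 4 * Real.pi ^ 2 * ∑ k ∈ freqBall N,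
      Torus.diagSymbol a k * ‖mFourierCoeff (fun x => (θ τ x : ℂ)) k‖ ^ 2) (Ioo 0 T) volume := by
  have hsum : IntegrableOn (fun τ => 4 * Real.pi ^ 2 * ∑ k ∈ freqBall N, Torus.diagSymbol a k *
      ((∫ x, θ τ x * reTrigPoly {-k} (fun _ => (1 : ℂ)) x) * (∫ x, θ τ x * reTrigPoly {-k} (fun _ => (1 : ℂ)) x) +
      (∫ x, θ τ x * reTrigPoly {-k} (fun _ => -Complex.I) x) * (∫ x, θ τ x * reTrigPoly {-k} (fun _ => -Complex.I) x)))
      (Ioo 0 T) volume :=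
    (integrable_finsetSum _ fun k _ => (h.integrableOn_pairing_sq k).const_mul _).const_mul _
  refine hsum.congr_fun_ae ?_
  filter_upwards [h.ae_slice_integrable] with τ hτ
  simp only [sq_norm_mFourierCoeff_ofReal hτ.1, sq]

/-- **The Galerkin transport pairing is integrable in time**: `τ ↦ ∫ θ(τ) ⟪u(τ), ∇P_N θ(τ)⟫ ∈ L¹(0,T)`.
[cite: RobinsonRodrigoSadowski2016, §4.2 (Galerkin energy estimate)] -/
theorem integrableOn_galerkin_transport (h : IsWeakScalarTransportDiagForcedOn T a κ u s θ₀ θ) (N : ℕ) :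
    IntegrableOn (fun τ => ∫ x, θ τ x * ⟪u τ x, gradient (scalarTruncate N (θ τ)) x⟫_ℝ) (Ioo 0 T) volume := by
  have hsum : IntegrableOn (fun τ => ∑ k ∈ freqBall N,
      ((∫ x, θ τ x * reTrigPoly {-k} (fun _ => (1 : ℂ)) x) *
          (∫ x, θ τ x * ⟪u τ x, gradient (reTrigPoly {-k} (fun _ => (1 : ℂ))) x⟫_ℝ) +
        (∫ x, θ τ x * reTrigPoly {-k} (fun _ => -Complex.I) x) *
          (∫ x, θ τ x * ⟪u τ x, gradient (reTrigPoly {-k} (fun _ => -Complex.I)) x⟫_ℝ))) (Ioo 0 T) volume := by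
    refine integrable_finsetSum _ fun k _ => ?_
    have hC := isSmooth_reTrigPoly ({-k} : Finset (d → ℤ)) (fun _ => (1 : ℂ))
    have hS := isSmooth_reTrigPoly ({-k} : Finset (d → ℤ)) (fun _ => -Complex.I)
    have h1 := h.integrableOn_mul_pairing
      ((h.integrable_mul_inner_continuous hC.gradient.continuous).integral_prod_left) hC.continuous
    have h2 := h.integrableOn_mul_pairing
      ((h.integrable_mul_inner_continuous hS.gradient.continuous).integral_prod_left) hS.continuous
    refine (h1.add h2).congr_fun_ae (Eventually.of_forall fun τ => ?_)
    simp only [Pi.add_apply]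
    ring
  refine hsum.congr_fun_ae ?_
  filter_upwards [h.ae_slice_integrable] with τ hτ
  exact galerkin_sum_transport_eq hτ.1 hτ.2.1 hτ.2.2.1 N

/-- **The Galerkin source pairing is integrable in time**: `τ ↦ ∫ s(τ) P_N θ(τ) ∈ L¹(0,T)`.
[cite: RobinsonRodrigoSadowski2016, §4.2 (Galerkin energy estimate)] -/
theorem integrableOn_galerkin_source (h : IsWeakScalarTransportDiagForcedOn T a κ u s θ₀ θ) (N : ℕ) :
    IntegrableOn (fun τ => ∫ x, s τ x * scalarTruncate N (θ τ) x) (Ioo 0 T) volume := by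
  have hsum : IntegrableOn (fun τ => ∑ k ∈ freqBall N,
      ((∫ x, θ τ x * reTrigPoly {-k} (fun _ => (1 : ℂ)) x) * (∫ x, s τ x * reTrigPoly {-k} (fun _ => (1 : ℂ)) x) +
        (∫ x, θ τ x * reTrigPoly {-k} (fun _ => -Complex.I) x) *
          (∫ x, s τ x * reTrigPoly {-k} (fun _ => -Complex.I) x))) (Ioo 0 T) volume := by
    refine integrable_finsetSum _ fun k _ => ?_
    have hC := continuous_reTrigPoly ({-k} : Finset (d → ℤ)) (fun _ => (1 : ℂ))
    have hS := continuous_reTrigPoly ({-k} : Finset (d → ℤ)) (fun _ => -Complex.I)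
    have h1 := h.integrableOn_mul_pairing ((h.integrable_source_mul_continuous hC).integral_prod_left) hC
    have h2 := h.integrableOn_mul_pairing ((h.integrable_source_mul_continuous hS).integral_prod_left) hS
    refine (h1.add h2).congr_fun_ae (Eventually.of_forall fun τ => ?_)
    simp only [Pi.add_apply]
    ring
  refine hsum.congr_fun_ae ?_
  filter_upwards [h.ae_slice_integrable] with τ hτ
  exact galerkin_sum_source_eq hτ.1 hτ.2.2.2 N

/-! ## The transport term as a truncation remainder (bounded drift) -/

/-- For an `L^∞` drift the Galerkin transport pairing only sees the truncation remainder: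
`∫ θ ⟪u, ∇P_N θ⟫ = ∫ (θ - P_N θ) ⟪u, ∇P_N θ⟫` for a.e. `τ`, because `∫ P_N θ ⟪u, ∇P_N θ⟫ = 0`
by weak incompressibility (`P_N θ ⟪u, ∇P_N θ⟫ = ½ ⟪u, ∇(P_N θ)²⟫`; Robinson–Rodrigo–Sadowski 2016,
(4.20) `b(u,v,v) = 0`). [cite: RobinsonRodrigoSadowski2016, §4.2 (Galerkin energy estimate)] -/
theorem ae_galerkin_transport_eq_remainder (h : IsWeakScalarTransportDiagForcedOn T a κ u s θ₀ θ)
    (hu : MemLp (stLift u) ∞ (volume.restrict (Ioo 0 T ×ˢ univ))) (N : ℕ) :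
    ∀ᵐ τ ∂(volume.restrict (Ioo 0 T)),
      ∫ x, θ τ x * ⟪u τ x, gradient (scalarTruncate N (θ τ)) x⟫_ℝ =
        ∫ x, (θ τ x - scalarTruncate N (θ τ) x) * ⟪u τ x, gradient (scalarTruncate N (θ τ)) x⟫_ℝ := by
  obtain ⟨Cu, hCu0, hCu⟩ := ae_ae_norm_le_of_memLp_top_stLift hu
  filter_upwards [h.ae_slice_integrable, hCu, h.ae_isWeaklyDivFree] with τ hτ hb hdiv
  have hP := isSmooth_scalarTruncate N (θ τ)
  have hG : Continuous (gradient (scalarTruncate N (θ τ))) := hP.gradient.continuous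
  obtain ⟨MP, hMP⟩ := exists_forall_norm_le_of_continuous hP.continuous
  obtain ⟨MG, hMG⟩ := exists_forall_norm_le_of_continuous hG
  have h0 := integral_mul_inner_gradient_eq_zero hP hdiv
  have hI1 : Integrable (fun x => θ τ x * ⟪u τ x, gradient (scalarTruncate N (θ τ)) x⟫_ℝ) volume :=
    integrable_mul_inner_of_norm_mul hτ.1 hτ.2.1 hτ.2.2.1 hG
  have hI2 : Integrable (fun x => scalarTruncate N (θ τ) x * ⟪u τ x, gradient (scalarTruncate N (θ τ)) x⟫_ℝ)
      volume := by
    refine Integrable.mono' (integrable_const (MP * (Cu * MG)))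
      (hP.continuous.aestronglyMeasurable.mul (hτ.2.1.inner hG.aestronglyMeasurable)) ?_
    filter_upwards [hb] with x hx
    rw [norm_mul]
    exact mul_le_mul (hMP x) ((abs_real_inner_le_norm _ _).trans (mul_le_mul hx (hMG x) (norm_nonneg _) hCu0))
      (norm_nonneg _) ((norm_nonneg _).trans (hMP x))
  simp_rw [sub_mul]
  rw [integral_sub hI1 hI2, h0, sub_zero]

/-- The Galerkin transport remainder `τ ↦ ∫ (θ - P_N θ) ⟪u, ∇P_N θ⟫` is integrable on `(0,T)`
(bounded drift). [cite: RobinsonRodrigoSadowski2016, §4.2 (Galerkin energy estimate)] -/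
theorem integrableOn_galerkin_remainder (h : IsWeakScalarTransportDiagForcedOn T a κ u s θ₀ θ)
    (hu : MemLp (stLift u) ∞ (volume.restrict (Ioo 0 T ×ˢ univ))) (N : ℕ) :
    IntegrableOn (fun τ => ∫ x, (θ τ x - scalarTruncate N (θ τ) x) *
      ⟪u τ x, gradient (scalarTruncate N (θ τ)) x⟫_ℝ) (Ioo 0 T) volume :=
  (h.integrableOn_galerkin_transport N).congr_fun_ae (h.ae_galerkin_transport_eq_remainder hu N)

end IsWeakScalarTransportDiagForcedOn

end Torus

end Literature.Analysis.FluidPDE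

end
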